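import Literature.IUT.HodgeTheaters.SurfaceGroupFiniteIndexDischarge
import Literature.GroupTheory.CombinatorialGroupTheory.SurfaceGroupConjugacySeparableHolds
import HarnessLib

/-!
# [IUTchI] Theorem 2.6 and Corollary 2.8 AS TYPED — UNCONDITIONAL (F-2732 discharged)

Mochizuki, *Inter-universal Teichmüller theory I*, kurims manuscript (May 2020), §2, Theorem 2.6
"Profinite Conjugates of Discrete Subgroups" pp. 56–57 and Corollary 2.8 "Subgroups of Topological
Fundamental Groups of Complex Hyperbolic Curves" p. 59 [cite: Mochizuki2012, Thm 2.6 pp.56-57]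
(D-0012 claim key, status disputed — the items here are CLASSICAL (pro)finite group theory and take no
side; Remark 2.8.1: off the route to [IUTchIII] Cor. 3.12).  PROOF-ONLY file (cell abc-iut, DAG nodes
`IUTchI:Thm2.6`, `IUTchI:Cor2.8`; FACT-LIST row F-2732).

The tree carried Theorem 2.6 / Corollary 2.8 AS TYPED (`ProfiniteConjugatesOfDiscreteSubgroups`,
`SubgroupsOfComplexHyperbolicPi1`, file `DiscreteProfiniteConjugates.lean`) modulo exactly ONE classical
named fact, `SurfaceGroupConjugacySeparable` (F-2732; [Stb2] = P. F. Stebe, Trans. AMS 163 (1972)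
Thm. 3.3, the printed input "[Stb2], Theorem 3.3" of p. 57 l. 9): `SurfaceGroupFiniteIndexDischarge.lean`
(abc-iut-w5-d200).  That fact is now a THEOREM of the tree —
`Literature.GroupTheory.CombinatorialGroupTheory.surfaceGroupConjugacySeparable_holds`
(`SurfaceGroupConjugacySeparableHolds.lean`: Dyer's finite-quotient route for `Sₙ ≅ F_{2(n-1)} *_ℤ F_2`).
This file plugs it in, WITHOUT editing any file of another seat:

* `FreeOrSurface.hcs_surface_holds` — hereditary conjugacy separability of orientable surface groups
  (every finite-index subgroup is conjugacy separable, finite-quotient form), unconditional;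
* `profiniteConjugatesOfDiscreteSubgroups_holds : ProfiniteConjugatesOfDiscreteSubgroups` —
  **Theorem 2.6 AS TYPED, unconditional**;
* `subgroupsOfComplexHyperbolicPi1_holds : SubgroupsOfComplexHyperbolicPi1` — **Corollary 2.8 AS
  TYPED, unconditional**.
(Lemma 2.7 (vi)(vii) were already unconditional: `FreeOrSurface.centralizerCommutatorKernelTrivial_holds`,
`…autFixingCommutatorKernelTrivial_holds`, file `DiscreteProfiniteConjugatesLemma27viPrinted.lean`.)

HONEST FRAMING: nothing here asserts abc proved or refuted; these are classical statements about free
and surface groups and their profinite completions, kernel-checked from Mathlib-level definitions.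
-/

namespace Literature.IUT.HodgeTheaters

open Literature.GroupTheory.CombinatorialGroupTheory

universe u

namespace FreeOrSurface

/-- **Hereditary conjugacy separability of orientable surface groups — unconditional**: every
finite-index subgroup of an orientable surface group is conjugacy separable (finite-quotient form);
"`G` is conjugacy separable … [Stb2], Theorem 3.3" (p. 57) applied to the finite-index subgroups `G₁`,
with [Stb2] = `surfaceGroupConjugacySeparable_holds` and Riemann–Hurwitz =
`surfaceGroupFiniteIndexSubgroup_holds`. [cite: Mochizuki2012, Thm 2.6 p.57] -/
theorem hcs_surface_holds (S : Type u) [Group S] (hS : IsOrientableSurfaceGroup S) (K : Subgroup S)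
    (hK : K.FiniteIndex) :
    ∀ u v : K, ¬ IsConj u v → ∃ (L : Subgroup K) (_ : L.Normal) (_ : L.FiniteIndex),
      ¬ IsConj (QuotientGroup.mk u : K ⧸ L) (QuotientGroup.mk v) :=
  hcs_surface_of_conjugacySeparable surfaceGroupConjugacySeparable_holds S hS K hK

/-- **[IUTchI] Theorem 2.6 (Profinite Conjugates of Discrete Subgroups) AS TYPED — UNCONDITIONAL.**
[cite: Mochizuki2012, Thm 2.6 pp.56-57] -/
theorem profiniteConjugatesOfDiscreteSubgroups_holds :
    Literature.IUT.HodgeTheaters.ProfiniteConjugatesOfDiscreteSubgroups.{u} :=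
  profiniteConjugatesOfDiscreteSubgroups_of_conjugacySeparable surfaceGroupConjugacySeparable_holds

/-- **[IUTchI] Corollary 2.8 (Subgroups of Topological Fundamental Groups of Complex Hyperbolic Curves)
AS TYPED — UNCONDITIONAL** (Remark 2.8.1: immediate from Theorem 2.6). [cite: Mochizuki2012, Cor 2.8 p.59] -/
theorem subgroupsOfComplexHyperbolicPi1_holds :
    Literature.IUT.HodgeTheaters.SubgroupsOfComplexHyperbolicPi1.{u} :=
  subgroupsOfComplexHyperbolicPi1_of_conjugacySeparable surfaceGroupConjugacySeparable_holds

end FreeOrSurface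

end Literature.IUT.HodgeTheaters
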